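import Mathlib
import HarnessLib
import Literature.Probability.MarkovChains.MetropolisHastings

/-!
# The penalty method: exact Metropolis sampling with Gaussian-noisy energy differences

Topic `Probability/MarkovChains`.  PUBLISHED RESULT with our formalisation of the printed proof;
no named fact is introduced (every statement below is a definition with a body or a theorem).

Source: D. M. Ceperley, M. Dewing, *The penalty method for random walks with uncertain energies*,
J. Chem. Phys. 110 (1999) 9812 [arXiv:physics/9812035], §2 "Detailed balance with uncertainty".
Restated with its exactness claim in G. K. Nicholls, C. Fox, A. M. Watt, *Coupled MCMC with a
randomized acceptance probability*, arXiv:1205.6857, §3 Algorithm 4 ("Ceperley & Dewing 1999 show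
that the following algorithm, which they call the `penalty method', targets π(θ) exactly"; the
log-ratio estimate is Gaussian with known, symmetric variance `σ(θ, θ') = σ(θ', θ)`).

Setting [CD §2].  A Metropolis chain for `π(s) ∝ e^{−V(s)}` with proposal `T(s → s')`, in which
only a NOISY estimate `δ` of the exact log-ratio
`Δ(s → s') = [V(s') − V(s)] − ln[T(s' → s)/T(s → s')]` (their eq. for `Δ`) is available, `δ`
drawn afresh at every attempted move with law `P(δ; s → s')`, and the move is taken with a
probability `a(δ)` depending on the estimate only.  The AVERAGE acceptance is
`A(s → s') = ∫ dδ P(δ; s → s') a(δ)` (eq. `defA`) and detailed balance of the resulting Markov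
chain on states is exactly `A(s → s') = e^{−Δ} A(s' → s)` (eq. `MDB`).  For normally distributed
noise with KNOWN variance, `P = N(Δ, σ²)` (eq. `normal`), "we have found a very simple exact
solution":

  `a_P(δ; σ) = min(1, exp(−δ − σ²/2))`                                    (eq. `1psol`)

"The uncertainty in the action just causes a reduction in the acceptance probability by an amount
`exp(−σ²/2)` for `δ > −σ²/2`" — the NOISE PENALTY `u = σ²/2` — and "clearly, the formula reverts
to the usual Metropolis formula when the noise vanishes".  Printed proof: "one does the integrals
in Eq. (defA) to obtain `A(Δ) = ½[e^{−Δ} erfc(c(σ²/2 − Δ)) + erfc(c(σ²/2 + Δ))]`,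
`c = 1/√(2σ²)`", from which `A(Δ) = e^{−Δ} A(−Δ)` is read off.

Lean reading.  Variance `v = σ² : ℝ≥0`, noise law `gaussianReal Δ v` (Mathlib); the Gaussian
upper tail `Φc_v(z) = N(0, v)(z, ∞) = ½ erfc(z/√(2v))` is kept as a measure of a half-line and
ALSO rewritten as the printed complementary-error-function integral (DLMF 7.2.2,
`erfc x = (2/√π)∫_x^∞ e^{−u²} du`; no new definition).  The finite-state-space consequence uses
the tree's `DetailedBalance` / `IsStationary` (`MetropolisHastings.lean`).

Contents (all proved):
* `penaltyAccept u δ = min 1 (exp (−δ − u))` — eq. (1psol) with penalty `u`; `penaltyAccept_zero`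
  (no noise ⇒ Metropolis), bounds `0 ≤ a_P ≤ 1` ("we must have that `0 ≤ a(δ) ≤ 1` since `a` is a
  probability");
* `penaltyAvgAccept v Δ = ∫ a_P(δ; v/2) dN(Δ, v)(δ)` — eq. (defA) under (normal);
  `penaltyAvgAccept_zero_var` (σ = 0 ⇒ `min(1, e^{−Δ})`);
* `penaltyAvgAccept_eq_tails` — the printed closed form
  `A(Δ) = e^{−Δ}·Φc_v(v/2 − Δ) + Φc_v(v/2 + Δ)` (= `½[e^{−Δ} erfc(c(σ²/2 − Δ)) + erfc(c(σ²/2 + Δ))]`),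
  and `gaussianReal_Ioi_eq_erfc` — `Φc_v(z) = (1/√π) ∫_{u > z/√(2v)} e^{−u²} du = ½ erfc(c z)`;
* `penaltyAvgAccept_detailedBalance` — eq. (MDB): `A(Δ) = e^{−Δ} A(−Δ)` for every `v` (the
  exactness of the penalty method); `penaltyAvgAccept_le_metropolis` — `A(Δ) ≤ min(1, e^{−Δ})`
  (CD §3.1: `ξ_P = −σ²/2`; Nicholls–Fox–Watt: the penalty method is an r-algorithm, `α_ξ ≤ α`);
* `penaltyKernel_detailedBalance`, `penaltyKernel_isStationary` — on a finite state space, the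
  chain "propose with `T`, estimate `Δ` with Gaussian noise of known symmetric variance
  `v x y = v y x`, accept with `a_P`" has `π` as a reversible, hence stationary, law — "achieve exact
  sampling even with very strong noise" [CD, abstract].

What is NOT covered (and is not claimed in print either): an ESTIMATED variance (CD §4: the
Bessel-corrected formula is only asymptotically exact — the "Penalty Estimate method … is
inexact" in the words of Nicholls–Fox–Watt, Algorithm 5) and non-Gaussian noise (CD §5).

Context (cell pub-lqcd, HOME/R2-SCOPE.md §3 D7/N5): this is the exactness clause of route D7
(penalty-corrected noisy acceptance) — exact for Gaussian log-ratio noise of KNOWN variance, by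
the theorem below; nothing here asserts that a pseudofermion/stochastic-trace estimate IS Gaussian.
-/

namespace Literature.Probability.MarkovChains

open MeasureTheory ProbabilityTheory Set Finset
open scoped NNReal ENNReal

/-! ## The penalty acceptance `a_P` and its Gaussian average `A(Δ)` -/

section Acceptance

/-- The PENALTY acceptance probability `a_P(δ; σ) = min(1, exp(−δ − u))` with noise penalty
`u = σ²/2`, as a function of the penalty `u` and the noisy log-ratio estimate `δ`.
[cite: CeperleyDewing1999, §2 eq. (1psol) "a_P(δ;σ) = min(1, exp(−δ − σ²/2))"] -/
noncomputable def penaltyAccept (u δ : ℝ) : ℝ := min 1 (Real.exp (-δ - u))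

/-- `a_P` is a probability: `0 ≤ a_P`. [cite: CeperleyDewing1999, §2 ("we must have that
0 ≤ a(δ) ≤ 1 since a is a probability")] -/
theorem penaltyAccept_nonneg (u δ : ℝ) : 0 ≤ penaltyAccept u δ :=
  le_min zero_le_one (Real.exp_pos _).le

/-- `a_P` is a probability: `a_P ≤ 1`. [cite: CeperleyDewing1999, §2] -/
theorem penaltyAccept_le_one (u δ : ℝ) : penaltyAccept u δ ≤ 1 := min_le_left _ _

/-- Below the threshold `δ ≤ −u` the move is always accepted. [cite: CeperleyDewing1999, §2
("reduction in the acceptance probability … for δ > −σ²/2")] -/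
theorem penaltyAccept_of_le {u δ : ℝ} (h : δ ≤ -u) : penaltyAccept u δ = 1 :=
  min_eq_left (Real.one_le_exp (by linarith))

/-- Above the threshold the acceptance is the penalised Boltzmann factor `exp(−δ − u)`.
[cite: CeperleyDewing1999, §2] -/
theorem penaltyAccept_of_lt {u δ : ℝ} (h : -u < δ) : penaltyAccept u δ = Real.exp (-δ - u) :=
  min_eq_right (Real.exp_le_one_iff.mpr (by linarith))

/-- "Clearly, the formula reverts to the usual Metropolis formula when the noise vanishes":
`a_P(δ; 0) = min(1, e^{−δ})`. [cite: CeperleyDewing1999, §2] -/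
theorem penaltyAccept_zero (δ : ℝ) : penaltyAccept 0 δ = min 1 (Real.exp (-δ)) := by
  simp [penaltyAccept]

/-- The AVERAGE acceptance `A(Δ) = ∫ dδ P(δ) a_P(δ; σ)` for Gaussian noise `P = N(Δ, σ²)` of known
variance `v = σ²` around the exact log-ratio `Δ`. [cite: CeperleyDewing1999, §2 eqs. (defA),
(normal)] -/
noncomputable def penaltyAvgAccept (v : ℝ≥0) (Δ : ℝ) : ℝ :=
  ∫ δ, penaltyAccept ((v : ℝ) / 2) δ ∂gaussianReal Δ v

/-- Without noise (`σ = 0`, the estimate IS `Δ`) the average acceptance is Metropolis'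
`min(1, e^{−Δ})`. [cite: CeperleyDewing1999, §2] -/
theorem penaltyAvgAccept_zero_var (Δ : ℝ) : penaltyAvgAccept 0 Δ = min 1 (Real.exp (-Δ)) := by
  rw [penaltyAvgAccept, gaussianReal_zero_var, integral_dirac, NNReal.coe_zero, zero_div,
    penaltyAccept_zero]

/-- The penalised Boltzmann factor TILTS the noise law: `e^{−δ − v/2} φ_{Δ, v}(δ) = e^{−Δ} φ_{Δ − v, v}(δ)`
(completing the square; this is "doing the integrals in (defA)"; private helper). [folklore] -/
private theorem exp_penalty_mul_gaussianPDFReal {v : ℝ≥0} (hv : v ≠ 0) (Δ δ : ℝ) :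
    Real.exp (-δ - (v : ℝ) / 2) * gaussianPDFReal Δ v δ =
      Real.exp (-Δ) * gaussianPDFReal (Δ - v) v δ := by
  have hv' : (v : ℝ) ≠ 0 := NNReal.coe_ne_zero.mpr hv
  simp only [gaussianPDFReal]
  have key : -δ - (v : ℝ) / 2 + -(δ - Δ) ^ 2 / (2 * (v : ℝ)) =
      -Δ + -(δ - (Δ - (v : ℝ))) ^ 2 / (2 * (v : ℝ)) := by
    field_simp
    ring
  calc Real.exp (-δ - (v : ℝ) / 2) *
        ((Real.sqrt (2 * Real.pi * (v : ℝ)))⁻¹ * Real.exp (-(δ - Δ) ^ 2 / (2 * (v : ℝ))))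
      = (Real.sqrt (2 * Real.pi * (v : ℝ)))⁻¹ *
          Real.exp (-δ - (v : ℝ) / 2 + -(δ - Δ) ^ 2 / (2 * (v : ℝ))) := by
        rw [Real.exp_add]; ring
    _ = (Real.sqrt (2 * Real.pi * (v : ℝ)))⁻¹ *
          Real.exp (-Δ + -(δ - (Δ - (v : ℝ))) ^ 2 / (2 * (v : ℝ))) := by rw [key]
    _ = Real.exp (-Δ) *
          ((Real.sqrt (2 * Real.pi * (v : ℝ)))⁻¹ * Real.exp (-(δ - (Δ - (v : ℝ))) ^ 2 / (2 * (v : ℝ)))) := by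
        rw [Real.exp_add]; ring

/-- For a non-degenerate Gaussian, `(N s).toReal = ∫_s φ` (private helper). [folklore] -/
private theorem toReal_gaussianReal_eq_setIntegral (m : ℝ) {v : ℝ≥0} (hv : v ≠ 0) {s : Set ℝ}
    (hs : MeasurableSet s) :
    (gaussianReal m v s).toReal = ∫ x in s, gaussianPDFReal m v x := by
  rw [gaussianReal_apply_eq_integral m hv s,
    ENNReal.toReal_ofReal (setIntegral_nonneg hs fun x _ => gaussianPDFReal_nonneg m v x)]

/-- **The printed closed form of the average acceptance** ("one does the integrals in (defA)"):
for `v = σ² ≠ 0`,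
`A(Δ) = e^{−Δ} · N(0, v)(v/2 − Δ, ∞) + N(0, v)(v/2 + Δ, ∞)`, i.e.
`A(Δ) = ½[e^{−Δ} erfc(c(σ²/2 − Δ)) + erfc(c(σ²/2 + Δ))]` with `c = 1/√(2σ²)` since
`N(0, v)(z, ∞) = ½ erfc(c z)` (`gaussianReal_Ioi_eq_erfc`).  Proof: split at the threshold
`δ = −v/2`; below it `a_P = 1` contributes `N(Δ, v)(−∞, −v/2] = N(0, v)[v/2 + Δ, ∞)` by the
symmetry of the Gaussian; above it the penalised factor tilts `N(Δ, v)` into `e^{−Δ} N(Δ − v, v)`,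
contributing `e^{−Δ} N(Δ − v, v)(−v/2, ∞) = e^{−Δ} N(0, v)(v/2 − Δ, ∞)`.
[cite: CeperleyDewing1999, §2 (the display for `A(Δ)` after eq. (1psol))] -/
theorem penaltyAvgAccept_eq_tails {v : ℝ≥0} (hv : v ≠ 0) (Δ : ℝ) :
    penaltyAvgAccept v Δ =
      Real.exp (-Δ) * (gaussianReal 0 v (Ioi ((v : ℝ) / 2 - Δ))).toReal +
        (gaussianReal 0 v (Ioi ((v : ℝ) / 2 + Δ))).toReal := by
  set u : ℝ := (v : ℝ) / 2 with hu
  rw [penaltyAvgAccept, integral_gaussianReal_eq_integral_smul hv]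
  simp only [smul_eq_mul]
  have hf_int : Integrable (fun δ => gaussianPDFReal Δ v δ * penaltyAccept u δ) := by
    refine (integrable_gaussianPDFReal Δ v).mono' ?_ (ae_of_all _ fun δ => ?_)
    · exact ((measurable_gaussianPDFReal Δ v).mul (measurable_const.min
        (Real.measurable_exp.comp (measurable_neg.sub_const u)))).aestronglyMeasurable
    · rw [Real.norm_eq_abs, abs_of_nonneg (mul_nonneg (gaussianPDFReal_nonneg _ _ _)
        (penaltyAccept_nonneg u δ))]
      exact mul_le_of_le_one_right (gaussianPDFReal_nonneg _ _ _) (penaltyAccept_le_one u δ)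
  rw [← integral_add_compl (measurableSet_Iic (a := -u)) hf_int]
  -- piece `δ ≤ −u`: always accepted, the integrand is the density itself
  have h1 : ∫ δ in Iic (-u), gaussianPDFReal Δ v δ * penaltyAccept u δ =
      (gaussianReal Δ v (Iic (-u))).toReal := by
    rw [toReal_gaussianReal_eq_setIntegral Δ hv measurableSet_Iic]
    refine setIntegral_congr_fun measurableSet_Iic fun δ hδ => ?_
    rw [penaltyAccept_of_le (mem_Iic.mp hδ), mul_one]
  -- piece `δ > −u`: the penalised factor tilts `N(Δ, v)` into `e^{−Δ} N(Δ − v, v)`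
  have h2 : ∫ δ in (Iic (-u))ᶜ, gaussianPDFReal Δ v δ * penaltyAccept u δ =
      Real.exp (-Δ) * (gaussianReal (Δ - v) v (Ioi (-u))).toReal := by
    rw [toReal_gaussianReal_eq_setIntegral (Δ - v) hv measurableSet_Ioi, compl_Iic,
      ← integral_const_mul]
    refine setIntegral_congr_fun measurableSet_Ioi fun δ hδ => ?_
    rw [penaltyAccept_of_lt (mem_Ioi.mp hδ), mul_comm, hu, exp_penalty_mul_gaussianPDFReal hv Δ δ]
  -- centring: `N(Δ − v, v)(−u, ∞) = N(0, v)(v/2 − Δ, ∞)`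
  have h3 : gaussianReal (Δ - v) v (Ioi (-u)) = gaussianReal 0 v (Ioi ((v : ℝ) / 2 - Δ)) := by
    rw [show gaussianReal (Δ - v) v = (gaussianReal 0 v).map (· + (Δ - (v : ℝ))) by
        rw [gaussianReal_map_add_const, zero_add],
      Measure.map_apply (measurable_add_const _) measurableSet_Ioi, preimage_add_const_Ioi]
    congr 2
    rw [hu]; ring
  -- centring and symmetry: `N(Δ, v)(−∞, −u] = N(0, v)(−∞, −u − Δ] = N(0, v)[v/2 + Δ, ∞)`
  have h4 : gaussianReal Δ v (Iic (-u)) = gaussianReal 0 v (Ioi ((v : ℝ) / 2 + Δ)) := by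
    rw [show gaussianReal Δ v = (gaussianReal 0 v).map (· + Δ) by
        rw [gaussianReal_map_add_const, zero_add],
      Measure.map_apply (measurable_add_const _) measurableSet_Iic, preimage_add_const_Iic]
    have hneg : (gaussianReal 0 v).map (fun x : ℝ => -x) = gaussianReal 0 v := by
      rw [gaussianReal_map_neg, neg_zero]
    haveI := nullSingletonClass_gaussianReal (μ := (0 : ℝ)) hv
    conv_lhs => rw [← hneg]
    rw [Measure.map_apply measurable_neg measurableSet_Iic,
      show (fun x : ℝ => -x) ⁻¹' Iic (-u - Δ) = Ici (u + Δ) by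
        ext x; simp only [Set.mem_preimage, Set.mem_Iic, Set.mem_Ici]; constructor <;> intro h <;> linarith,
      measure_congr Ioi_ae_eq_Ici.symm]
  rw [h1, h2, h3, h4, add_comm]

/-- **The Gaussian upper tail as the printed complementary error function**: for `v ≠ 0`,
`N(0, v)(z, ∞) = (1/√π) ∫_{u > z/√(2v)} e^{−u²} du = ½ erfc(z/√(2v)) = ½ erfc(c z)`, `c = 1/√(2σ²)`
(substitution `x = √(2v)·u`; `erfc` written out as the DLMF 7.2.2 integral).
[cite: CeperleyDewing1999, §2 ("where erfc(z) is the complimentary error function and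
c = 1/√(2σ²)")] -/
theorem gaussianReal_Ioi_eq_erfc {v : ℝ≥0} (hv : v ≠ 0) (z : ℝ) :
    (gaussianReal 0 v (Ioi z)).toReal =
      1 / Real.sqrt Real.pi * ∫ u in Ioi (z / Real.sqrt (2 * (v : ℝ))), Real.exp (-u ^ 2) := by
  have hv0 : (0 : ℝ) < v := by exact_mod_cast pos_iff_ne_zero.mpr hv
  have hc : 0 < Real.sqrt (2 * (v : ℝ)) := Real.sqrt_pos.mpr (by positivity)
  rw [toReal_gaussianReal_eq_setIntegral 0 hv measurableSet_Ioi]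
  have hsub := integral_comp_mul_left_Ioi (fun x => gaussianPDFReal 0 v x)
    (z / Real.sqrt (2 * (v : ℝ))) hc
  rw [mul_div_cancel₀ _ hc.ne'] at hsub
  -- `hsub : ∫ u in Ioi (z/√(2v)), φ(√(2v)·u) du = (√(2v))⁻¹ • ∫ x in Ioi z, φ x dx`
  have hphi : ∀ u : ℝ, gaussianPDFReal 0 v (Real.sqrt (2 * (v : ℝ)) * u) =
      (Real.sqrt (2 * Real.pi * (v : ℝ)))⁻¹ * Real.exp (-u ^ 2) := by
    intro u
    simp only [gaussianPDFReal, sub_zero]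
    congr 2
    rw [mul_pow, Real.sq_sqrt (by positivity : (0 : ℝ) ≤ 2 * (v : ℝ))]
    field_simp
  simp_rw [hphi, integral_const_mul, smul_eq_mul] at hsub
  have key : ∫ x in Ioi z, gaussianPDFReal 0 v x =
      Real.sqrt (2 * (v : ℝ)) * ((Real.sqrt (2 * Real.pi * (v : ℝ)))⁻¹ *
        ∫ u in Ioi (z / Real.sqrt (2 * (v : ℝ))), Real.exp (-u ^ 2)) := by
    rw [hsub, ← mul_assoc, mul_inv_cancel₀ hc.ne', one_mul]
  rw [key, ← mul_assoc]
  congr 1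
  rw [show 2 * Real.pi * (v : ℝ) = Real.pi * (2 * (v : ℝ)) by ring,
    Real.sqrt_mul Real.pi_pos.le, mul_inv, mul_comm (Real.sqrt Real.pi)⁻¹, ← mul_assoc,
    mul_inv_cancel₀ hc.ne', one_mul, one_div]

/-- **Detailed balance of the penalty method** (eq. (MDB)): for Gaussian noise of known variance
`v = σ²` — and trivially for `v = 0` — the average penalty acceptance satisfies
`A(Δ) = e^{−Δ} A(−Δ)` for every exact log-ratio `Δ`: "a very simple exact solution to Eq. (inteq)".
[cite: CeperleyDewing1999, §2 eqs. (MDB), (inteq), (1psol) ("To prove Eq. (1psol) satisfies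
Eq. (MDB), one does the integrals")]; [cite: NichollsFoxWatt2012, §3 Algorithm 4 ("Ceperley and
Dewing 1999 show that detailed balance is satisfied by carrying out the integrals over y_t")] -/
theorem penaltyAvgAccept_detailedBalance (v : ℝ≥0) (Δ : ℝ) :
    penaltyAvgAccept v Δ = Real.exp (-Δ) * penaltyAvgAccept v (-Δ) := by
  by_cases hv : v = 0
  · subst hv
    rw [penaltyAvgAccept_zero_var, penaltyAvgAccept_zero_var, neg_neg,
      (monotone_mul_left_of_nonneg (Real.exp_pos (-Δ)).le).map_min, mul_one, ← Real.exp_add,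
      neg_add_cancel, Real.exp_zero, min_comm]
  · rw [penaltyAvgAccept_eq_tails hv, penaltyAvgAccept_eq_tails hv, neg_neg, sub_neg_eq_add,
      ← sub_eq_add_neg, mul_add, ← mul_assoc, ← Real.exp_add, neg_add_cancel, Real.exp_zero,
      one_mul, add_comm]

/-- The average acceptance is a probability: `A(Δ) ≤ 1`. [cite: CeperleyDewing1999, §2] -/
theorem penaltyAvgAccept_le_one (v : ℝ≥0) (Δ : ℝ) : penaltyAvgAccept v Δ ≤ 1 := by
  unfold penaltyAvgAccept
  have hint : Integrable (fun δ => penaltyAccept ((v : ℝ) / 2) δ) (gaussianReal Δ v) := by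
    refine (integrable_const (1 : ℝ)).mono' ?_ (ae_of_all _ fun δ => ?_)
    · exact (measurable_const.min
        (Real.measurable_exp.comp (measurable_neg.sub_const _))).aestronglyMeasurable
    · rw [Real.norm_eq_abs, abs_of_nonneg (penaltyAccept_nonneg _ _)]
      exact penaltyAccept_le_one _ _
  calc ∫ δ, penaltyAccept ((v : ℝ) / 2) δ ∂gaussianReal Δ v
      ≤ ∫ _δ, (1 : ℝ) ∂gaussianReal Δ v :=
        integral_mono hint (integrable_const 1) fun _ => penaltyAccept_le_one _ _
    _ = 1 := by simp

/-- The average acceptance is a probability: `0 ≤ A(Δ)`. [cite: CeperleyDewing1999, §2] -/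
theorem penaltyAvgAccept_nonneg (v : ℝ≥0) (Δ : ℝ) : 0 ≤ penaltyAvgAccept v Δ :=
  integral_nonneg fun δ => penaltyAccept_nonneg _ δ

/-- **The price of the noise**: the penalty method's average acceptance never exceeds the
noise-free Metropolis acceptance, `A(Δ) ≤ min(1, e^{−Δ})` — Ceperley–Dewing's efficiency measure
`ξ_P = ∫(a_P − a_M) = −σ²/2 < 0` in the Peskun order ("it is always better to accept moves");
Nicholls–Fox–Watt's `α_ξ ≤ α` for every randomized (r-)algorithm, of which the penalty method is
one. [cite: CeperleyDewing1999, §3.1]; [cite: NichollsFoxWatt2012, §2.3 (the display α_ξ ≤ α, proved in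
App. A); §3 after Algorithm 4 ("the penalty method is an r-algorithm")] -/
theorem penaltyAvgAccept_le_metropolis (v : ℝ≥0) (Δ : ℝ) :
    penaltyAvgAccept v Δ ≤ min 1 (Real.exp (-Δ)) := by
  refine le_min (penaltyAvgAccept_le_one v Δ) ?_
  rw [penaltyAvgAccept_detailedBalance v Δ]
  exact mul_le_of_le_one_right (Real.exp_pos _).le (penaltyAvgAccept_le_one v (-Δ))

end Acceptance

/-! ## The consequence for the Markov chain on a finite state space -/

section Chain

variable {X : Type*} [Fintype X] [DecidableEq X]

/-- The exact log-ratio of a proposed move `x → y`: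
`Δ(x → y) = [V(y) − V(x)] − ln[T(y → x)/T(x → y)] = ln (π x · T x y) − ln (π y · T y x)` for
`π ∝ e^{−V}`, so that `e^{−Δ} = π y T y x / (π x T x y)` is the Hastings ratio.
[cite: CeperleyDewing1999, §2 (the definition of Δ(s → s'))] -/
noncomputable def penaltyDelta (T : X → X → ℝ) (π : X → ℝ) (x y : X) : ℝ :=
  Real.log (π x * T x y / (π y * T y x))

/-- Off-diagonal rate of the PENALTY chain: propose `y` with probability `T x y`, draw a Gaussian
estimate `δ ∼ N(Δ(x → y), v x y)` of the log-ratio, accept with `a_P(δ; √(v x y))`; averaged over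
the noise the rate is `T x y · A(Δ(x → y))` ("The overall transition rate is
`𝒫(s → s') = T(s → s') a(s → s')`" with `a` replaced by its noise average `A`, eq. (defA)).
[cite: CeperleyDewing1999, §1–§2] -/
noncomputable def penaltyRate (T : X → X → ℝ) (π : X → ℝ) (v : X → X → ℝ≥0) (x y : X) : ℝ :=
  T x y * penaltyAvgAccept (v x y) (penaltyDelta T π x y)

/-- The penalty chain's transition matrix on states: off the diagonal `penaltyRate`, the rejected
mass on the diagonal. [cite: CeperleyDewing1999, §1–§2] -/
noncomputable def penaltyKernel (T : X → X → ℝ) (π : X → ℝ) (v : X → X → ℝ≥0) (x y : X) : ℝ :=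
  if y = x then 1 - ∑ z ∈ univ.erase x, penaltyRate T π v x z else penaltyRate T π v x y

/-- Off-diagonal entries of the penalty kernel are the rates `T(s → s') A(s → s')`.
[cite: CeperleyDewing1999, §1 (the transition rule `𝒫(s → s') = T(s → s') a(s → s')`), §2 eq. (defA)] -/
theorem penaltyKernel_of_ne (T : X → X → ℝ) (π : X → ℝ) (v : X → X → ℝ≥0) {x y : X}
    (h : y ≠ x) : penaltyKernel T π v x y = penaltyRate T π v x y := if_neg h

/-- Diagonal entry of the penalty kernel: the walk stays put with the complementary probability.
[cite: CeperleyDewing1999, §1 (the transition rule `𝒫(s → s')`, rejected moves keep the state)] -/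
theorem penaltyKernel_self (T : X → X → ℝ) (π : X → ℝ) (v : X → X → ℝ≥0) (x : X) :
    penaltyKernel T π v x x = 1 - ∑ z ∈ univ.erase x, penaltyRate T π v x z := if_pos rfl

/-- Rows of the penalty kernel sum to one (it is a transition probability).
[cite: CeperleyDewing1999, §1 ("a fixed transition rule, 𝒫(s → s')")] -/
theorem penaltyKernel_sum_eq_one (T : X → X → ℝ) (π : X → ℝ) (v : X → X → ℝ≥0) (x : X) :
    ∑ y, penaltyKernel T π v x y = 1 := by
  rw [← add_sum_erase _ _ (mem_univ x), penaltyKernel_self]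
  have : ∑ y ∈ univ.erase x, penaltyKernel T π v x y = ∑ y ∈ univ.erase x, penaltyRate T π v x y :=
    sum_congr rfl fun y hy => penaltyKernel_of_ne T π v (ne_of_mem_erase hy)
  rw [this]
  ring

omit [Fintype X] [DecidableEq X] in
/-- The log-ratio is antisymmetric: `Δ(y → x) = −Δ(x → y)`.
[cite: CeperleyDewing1999, §2 ("If the process to estimate δ is symmetric in s and s' then
P(δ; s' → s) = P(−δ; s → s')")] -/
theorem penaltyDelta_swap (T : X → X → ℝ) (π : X → ℝ) (x y : X) :
    penaltyDelta T π y x = -penaltyDelta T π x y := by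
  unfold penaltyDelta
  rw [← Real.log_inv, inv_div]

omit [Fintype X] [DecidableEq X] in
/-- `e^{−Δ(x → y)}` is the Hastings ratio `π y T y x / (π x T x y)`. [cite: CeperleyDewing1999,
§1 eq. for `q(s → s')`, §2] -/
theorem exp_neg_penaltyDelta {T : X → X → ℝ} {π : X → ℝ} {x y : X} (hx : 0 < π x * T x y)
    (hy : 0 < π y * T y x) :
    Real.exp (-penaltyDelta T π x y) = π y * T y x / (π x * T x y) := by
  unfold penaltyDelta
  rw [← Real.log_inv, inv_div, Real.exp_log (div_pos hy hx)]

/-- **The penalty method is exact on a finite state space**: for a positive weight `π`, a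
non-negative proposal matrix whose zero pattern is symmetric (`T x y = 0 → T y x = 0`), and Gaussian
log-ratio noise of known, SYMMETRIC variance `v x y = v y x` ("the process to estimate δ is
symmetric in s and s'"), the penalty chain is in detailed balance with `π`.
[cite: CeperleyDewing1999, §2 (detailed balance eq. before (MDB); abstract: "achieve exact sampling
even with very strong noise")] -/
theorem penaltyKernel_detailedBalance {π : X → ℝ} (hπ : ∀ x, 0 < π x) {T : X → X → ℝ}
    (hT : ∀ x y, 0 ≤ T x y) (hT0 : ∀ x y, T x y = 0 → T y x = 0) {v : X → X → ℝ≥0}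
    (hv : ∀ x y, v x y = v y x) : DetailedBalance π (penaltyKernel T π v) := by
  intro x y
  by_cases h : y = x
  · subst h; rfl
  rw [penaltyKernel_of_ne T π v h, penaltyKernel_of_ne T π v (Ne.symm h)]
  unfold penaltyRate
  by_cases hxy : T x y = 0
  · rw [hxy, hT0 x y hxy]; simp
  have hyx : T y x ≠ 0 := fun h' => hxy (hT0 y x h')
  have hxy' : 0 < π x * T x y := mul_pos (hπ x) (lt_of_le_of_ne (hT x y) (Ne.symm hxy))
  have hyx' : 0 < π y * T y x := mul_pos (hπ y) (lt_of_le_of_ne (hT y x) (Ne.symm hyx))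
  rw [penaltyAvgAccept_detailedBalance (v x y), exp_neg_penaltyDelta hxy' hyx',
    ← penaltyDelta_swap T π x y, hv x y]
  set P := penaltyAvgAccept (v y x) (penaltyDelta T π y x)
  calc π x * (T x y * (π y * T y x / (π x * T x y) * P))
      = (π x * T x y) / (π x * T x y) * (π y * (T y x * P)) := by ring
    _ = π y * (T y x * P) := by rw [div_self hxy'.ne', one_mul]

/-- **Stationarity**: under the same hypotheses `π` is stationary for the penalty chain — the
noisy-energy random walk samples `π` exactly. [cite: CeperleyDewing1999, abstract and §2] -/
theorem penaltyKernel_isStationary {π : X → ℝ} (hπ : ∀ x, 0 < π x) {T : X → X → ℝ}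
    (hT : ∀ x y, 0 ≤ T x y) (hT0 : ∀ x y, T x y = 0 → T y x = 0) {v : X → X → ℝ≥0}
    (hv : ∀ x y, v x y = v y x) : IsStationary π (penaltyKernel T π v) :=
  (penaltyKernel_detailedBalance hπ hT hT0 hv).isStationary (penaltyKernel_sum_eq_one T π v)

omit [Fintype X] [DecidableEq X] in
/-- Without noise (`v ≡ 0`) the penalty chain IS the Metropolis–Hastings chain of the tree
(`mhKernel`), for positive `π` and positive `T`. [cite: CeperleyDewing1999, §2 ("reverts to the
usual Metropolis formula when the noise vanishes")] -/
theorem penaltyRate_zero_var {π : X → ℝ} (hπ : ∀ x, 0 < π x) {T : X → X → ℝ}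
    (hT : ∀ x y, 0 < T x y) (x y : X) :
    penaltyRate T π (fun _ _ => 0) x y = mhRate T π x y := by
  unfold penaltyRate mhRate
  have hxy : 0 < π x * T x y := mul_pos (hπ x) (hT x y)
  have hyx : 0 < π y * T y x := mul_pos (hπ y) (hT y x)
  rw [penaltyAvgAccept_zero_var, exp_neg_penaltyDelta hxy hyx,
    (monotone_mul_left_of_nonneg (hT x y).le).map_min, mul_one]
  congr 1
  calc T x y * (π y * T y x / (π x * T x y)) = T x y / T x y * (π y * T y x / π x) := by ring
    _ = π y * T y x / π x := by rw [div_self (hT x y).ne', one_mul]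

end Chain

end Literature.Probability.MarkovChains
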